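import Summits.ResolutionOfSingularities.ResolutionOfSingularities.Theorems.JetCutMixed2
import Summits.ResolutionOfSingularities.ResolutionOfSingularities.Theorems.JetCutDegenerate
import HarnessLib

/-!
# JetCutDegenerate2 — decomp-res node «JetCut» (lens-2 g15 rev 5), file 2/2 of `JetCutDegenerate`

Content VERBATIM from the decomp-res lens-2 file `HOME/decomp-res-lens-2/g15/JetCut.lean` rev 5 (pin 9f53e5ca =
`parts/JetCut-rev5-9f53e5ca.lean`, 7 495 l;
HOME = run/shared/lean/pub/decomp-res; CRITIC-LEDGER rows 109 / 115 / 120 / 121 / 122 / 127 / 133 CLEARED; landing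
order INBOX :231; the critic's
HYGIENE-landing.md h1–h11 applied — DOCSTRING-ONLY).  The lens's blocks RESTATED VERBATIM from lens-2 g12 / g13 /
g14 (§R / §R13 / §R14) are DELETED:
they are the tree's `RelativeDeltaCut*` / `CurveLeafExit*` / `PinchCut*` modules (namespaces `RelativeDeltaCut`,
`CurveLeafExit`, `PinchCut`, opened;
the lens's `CurveLeafExitRestated.x` / `PinchCutRestated.x` are cited as `CurveLeafExit.x` / `PinchCut.x`, the three
pointwise engine edges of g12 as
`RelativeDeltaCut.x`).  Namespace `…Theorems.JetCut` (the lens's `Theses.JetCut` is gate-reserved), sub-namespaces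
`Tame` / `Wide` / `Broad` / `Vast`
as in the lens; file split only (tree files ≤ 400 lines): sections, variables and every declaration exactly as in
the lens, the long rev-0/1 prose
lives in HOME/decomp-res-lens-2/g15/NODE-g15.md §ARCHIVE-A (not in the tree).  Node files, in import order:
`JetCutJetKernels`, `JetCutPoint`, `JetCutClasses`, `JetCutKernels`, `JetCutTame`, `JetCutTameClasses`,
`JetCutTameKernels`, `JetCutLadder`, `JetCutWideClasses`, `JetCutWideKernels`, `JetCutMixed`, `JetCutBroadClasses`,
`JetCutBroadKernels`, `JetCutDegenerate`, `JetCutVastClasses`, `JetCutVastKernels`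
(each possibly continued `…2`, `…3`), then the wiring `MaxContactCutJetCut*` (in the Theses cone).  All `--supports
stmt-ResolutionOfSingularities-29273`
(`MaxContactCut.RungOne`); nothing closes 29273 — decided cells carry their engines as hypotheses, and exactly ONE
located-residual aside is booked on
the route for this column (`Vast.VastSpecialRung`, home `JetCutVastClasses`).

§N (rev 5): the DEGENERATE-VERTEX LADDER (D) — a DEPTH LAW for principal tails whose `W`-leader has a degenerate
vertex (`v^m·W^k`, `n ∤ k`): the degenerate kernels (`deg_chart_identity`, `deg_sidechart_identity`,
`deg_uchart_identity`, `deg_depth`, `deg_stop_degree`, `deg_no_cancel`, PROVED — next to `ladder_*` / `mixed_*`),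
`section DegField` / `DegRing` shape lemmas, §N2 point level: `IsDegLadderAt`, uniformly shaped curves, ENGINE (D)
`DegLadderExit` (HYGIENE h10), the VAST leaf (V) = (B) ∪ (D) with `VastExit`, the VAST-SPECIAL class
`IsVastSpecialPt` (bed visibly inhabited, HYGIENE h11) and the pointwise kernels.

Part 2/2 carries: `IsVastCurvePt`, `VastExit`, `IsVastSpecialPt`, `isVastCurvePt_of_isBroadCurvePt`,
`isVastCurvePt_of_isDegLadderCurvePt`, `isVastCurvePt_of_isWideCurvePt`, `isVastCurvePt_of_isMixedLadderCurvePt`,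
`isVastCurvePt_of_isJetTameCurvePt`, `isVastCurvePt_of_isLadderCurvePt`, `isVastCurvePt_of_isJetCurvePt`,
`isVastCurvePt_of_isConeTailCurvePt`, `broadExit_of_vastExit`, `degLadderExit_of_vastExit`, `wideExit_of_vastExit`,
`mixedLadderExit_of_vastExit`, `jetTameExit_of_vastExit`, `ladderExit_of_vastExit`, `jetExit_of_vastExit`,
`flatConeExit_of_vastExit`, `isCurveExitPt_of_isDegLadderCurvePt`, `isCurveExitPt_of_isVastCurvePt`,
`isBroadSpecialPt_of_isVastSpecialPt`, `isWideSpecialPt_of_isVastSpecialPt`, `isTameSpecialPt_of_isVastSpecialPt`,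
`not_isVastSpecialPt_of_isVastCurvePt`, `SeqVGen`.

(Sources: HunekeSwanson2006 Cor. 5.5.5; CossartJannsenSaito2020 Ch. 2, Thm. 3.6/3.7, Ch. 8; CossartPiltant2008 Prop.
4.2; CossartPiltant2019 Rem. 3.2; Hironaka1964 Ch. III; Hironaka1967; Hironaka1977; Moh1987; Giraud1975.)
-/

open CategoryTheory AlgebraicGeometry TopologicalSpace IsLocalRing
open Literature.AlgebraicGeometry.Resolution
open Summit.ResolutionOfSingularities.ResolutionOfSingularities.Theorems
open Summit.ResolutionOfSingularities.ResolutionOfSingularities.Theorems.WeakOrderReduction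
open Summit.ResolutionOfSingularities.ResolutionOfSingularities.Theorems.DeltaFaceCutClasses
open Summit.ResolutionOfSingularities.ResolutionOfSingularities.Theorems.RelativeDeltaCut
open Summit.ResolutionOfSingularities.ResolutionOfSingularities.Theorems.CurveLeafExit
open Summit.ResolutionOfSingularities.ResolutionOfSingularities.Theorems.PinchCut

namespace Summit.ResolutionOfSingularities.ResolutionOfSingularities.Theorems.JetCut

/-- **VAST-CURVE point** [rev 5] (leaf (V) = (B) ∪ (D)): broad-curve OR degenerate-ladder-curve.  DEFINITION (NEW
class). -/
def IsVastCurvePt {Y : Scheme.{0}} (I : Y.IdealSheafData) (n : ℕ) (y : Y) : Prop :=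
  IsBroadCurvePt I n y ∨ IsDegLadderCurvePt I n y

/-- **ENGINE (V)** = both engines (B) and (D).  STATEMENT (conjunction of engines). -/
def VastExit : Prop :=
  BroadExit ∧ DegLadderExit

/-- **VAST-SPECIAL core point** [rev 5] (THE RE-LOCATED CLASS): pinch-special and neither broad-curve nor
degenerate-ladder-curve (bed — VISIBLY INHABITED: the census bridge row `g = z³ + v(u₁+u₂)³ + (1+v²)u₁⁶ + u₁¹⁰ /𝔽₃`
(T-deg-ladder: Top dim 1,
ONE τ = 1 near point with PURE-CUBE initial form `(X₀ + u₁)³` at depth 1 — the purity jump of window item (i) by letter —,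
none at depth 2) is pinch-special and, by letter, in none of (J)/(CT)/(T) (a τ = 1 near point survives blow-up 1), (L′) (no
mixed monomial), (L)/(D) (after the maximal cube absorption `z′ = z + u₁²` (`(z′)³ = z³ + u₁⁶` in characteristic 3) the
`W⁶`-coefficient is `v²·unit`: `n = 3 ∣ 6` is excluded from both, and `u₁¹⁰` is no (L)-leader since `v²u₁⁶` has weight
`18 < 31`); full certification over all re-parametrisations = the (D⁺) task of NODE NEXT-g16.md; further beds: cancelling
edge forms / binary towers with no vertex monomial, non-principal germs, Sing/Tangle/Iso; NOT `z² + v(u₁+u₂)² + v·u₁⁵`,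
NOT `u₁⁵ + u₂⁵`, NOT `deeptail`, NOT `branch:2`; HYGIENE h11).
DEFINITION (NEW class). [folklore] -/
def IsVastSpecialPt {k : Type} [Field k] {Y : Scheme.{0}} (g : Y ⟶ Spec (.of k)) (hY : Scheme.IsRegular Y)
    (I : Y.IdealSheafData) (n : ℕ) (y : Y) : Prop :=
  IsPinchSpecialPt g hY I n y ∧ ¬ IsVastCurvePt I n y

/-- (B) ⊆ (V).  KERNEL (PROVED). [folklore] -/
theorem isVastCurvePt_of_isBroadCurvePt {Y : Scheme.{0}} {I : Y.IdealSheafData} {n : ℕ} {y : Y} :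
    IsBroadCurvePt I n y → IsVastCurvePt I n y :=
  Or.inl

/-- (D) ⊆ (V).  KERNEL (PROVED). [folklore] -/
theorem isVastCurvePt_of_isDegLadderCurvePt {Y : Scheme.{0}} {I : Y.IdealSheafData} {n : ℕ} {y : Y} :
    IsDegLadderCurvePt I n y → IsVastCurvePt I n y :=
  Or.inr

/-- (W) ⊆ (V).  KERNEL (PROVED). [folklore] -/
theorem isVastCurvePt_of_isWideCurvePt {Y : Scheme.{0}} {I : Y.IdealSheafData} {n : ℕ} {y : Y} :
    IsWideCurvePt I n y → IsVastCurvePt I n y :=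
  fun h => Or.inl (Or.inl h)

/-- (L′) ⊆ (V).  KERNEL (PROVED). [folklore] -/
theorem isVastCurvePt_of_isMixedLadderCurvePt {Y : Scheme.{0}} {I : Y.IdealSheafData} {n : ℕ} {y : Y} :
    IsMixedLadderCurvePt I n y → IsVastCurvePt I n y :=
  fun h => Or.inl (Or.inr h)

/-- (T) ⊆ (V).  KERNEL (PROVED). [folklore] -/
theorem isVastCurvePt_of_isJetTameCurvePt {Y : Scheme.{0}} {I : Y.IdealSheafData} {n : ℕ} {y : Y} :
    IsJetTameCurvePt I n y → IsVastCurvePt I n y :=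
  fun h => Or.inl (isBroadCurvePt_of_isJetTameCurvePt h)

/-- (L) ⊆ (V).  KERNEL (PROVED). [folklore] -/
theorem isVastCurvePt_of_isLadderCurvePt {Y : Scheme.{0}} {I : Y.IdealSheafData} {n : ℕ} {y : Y} :
    IsLadderCurvePt I n y → IsVastCurvePt I n y :=
  fun h => Or.inl (isBroadCurvePt_of_isLadderCurvePt h)

/-- (J) ⊆ (V).  KERNEL (PROVED). [folklore] -/
theorem isVastCurvePt_of_isJetCurvePt {Y : Scheme.{0}} {I : Y.IdealSheafData} {n : ℕ} {y : Y} :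
    IsJetCurvePt I n y → IsVastCurvePt I n y :=
  fun h => Or.inl (isBroadCurvePt_of_isJetCurvePt h)

/-- (CT) ⊆ (V), marking `n ≥ 2`.  KERNEL (PROVED). [folklore] -/
theorem isVastCurvePt_of_isConeTailCurvePt {Y : Scheme.{0}} {I : Y.IdealSheafData} {n : ℕ} (hn : 2 ≤ n) {y : Y} :
    IsConeTailCurvePt I n y → IsVastCurvePt I n y :=
  fun h => Or.inl (isBroadCurvePt_of_isConeTailCurvePt hn h)

/-- ENGINE (V) gives ENGINES (B), (D), (W), (L′), (T), (L), (J), (C).  KERNEL (PROVED). [folklore] -/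
theorem broadExit_of_vastExit (hV : VastExit) : BroadExit :=
  hV.1

/-- `degLadderExit_of_vastExit`: Auxiliary step of this node's calculus, VERBATIM from the lens file (see the module
docstring); the statement is its type. [folklore] -/
theorem degLadderExit_of_vastExit (hV : VastExit) : DegLadderExit :=
  hV.2

/-- `wideExit_of_vastExit`: Auxiliary step of this node's calculus, VERBATIM from the lens file (see the module
docstring); the statement is its type. [folklore] -/
theorem wideExit_of_vastExit (hV : VastExit) : WideExit :=
  hV.1.1

/-- `mixedLadderExit_of_vastExit`: Auxiliary step of this node's calculus, VERBATIM from the lens file (see the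
module docstring); the statement is its type. [folklore] -/
theorem mixedLadderExit_of_vastExit (hV : VastExit) : MixedLadderExit :=
  hV.1.2

/-- `jetTameExit_of_vastExit`: Auxiliary step of this node's calculus, VERBATIM from the lens file (see the module
docstring); the statement is its type. [folklore] -/
theorem jetTameExit_of_vastExit (hV : VastExit) : JetTameExit :=
  hV.1.1.1

/-- `ladderExit_of_vastExit`: Auxiliary step of this node's calculus, VERBATIM from the lens file (see the module
docstring); the statement is its type. [folklore] -/
theorem ladderExit_of_vastExit (hV : VastExit) : LadderExit :=
  hV.1.1.2

/-- `jetExit_of_vastExit`: Auxiliary step of this node's calculus, VERBATIM from the lens file (see the module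
docstring); the statement is its type. [folklore] -/
theorem jetExit_of_vastExit (hV : VastExit) : JetExit :=
  jetExit_of_broadExit hV.1

/-- `flatConeExit_of_vastExit`: Auxiliary step of this node's calculus, VERBATIM from the lens file (see the module
docstring); the statement is its type. [folklore] -/
theorem flatConeExit_of_vastExit (hV : VastExit) : FlatConeExit :=
  flatConeExit_of_broadExit hV.1

/-- Under ENGINE (D), every degenerate-ladder-curve point is a curve-exit point (the port's hypothesis shape).  KERNEL
(PROVED). [folklore] -/
theorem isCurveExitPt_of_isDegLadderCurvePt {Y : Scheme.{0}} {I : Y.IdealSheafData} {n : ℕ} {y : Y}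
    (hD : DegLadderExit) (hY : Scheme.IsRegular Y) (hn : 2 ≤ n) (h : IsDegLadderCurvePt I n y) :
    IsCurveExitPt I n y := by
  obtain ⟨η, m, k, hηy, hiso, hcurve⟩ := h
  exact ⟨η, hηy, hcurve.1, hiso, hD Y hY I n hn m k η hcurve⟩

/-- Under ENGINE (V), every vast-curve point is a curve-exit point.  KERNEL (PROVED). [folklore] -/
theorem isCurveExitPt_of_isVastCurvePt {Y : Scheme.{0}} {I : Y.IdealSheafData} {n : ℕ} {y : Y}
    (hV : VastExit) (hY : Scheme.IsRegular Y) (hn : 2 ≤ n) (h : IsVastCurvePt I n y) :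
    IsCurveExitPt I n y := by
  rcases h with h | h
  · exact isCurveExitPt_of_isBroadCurvePt hV.1 hY hn h
  · exact isCurveExitPt_of_isDegLadderCurvePt hV.2 hY hn h

/-- Vast-special ⇒ broad-special ⇒ wide-special ⇒ tame-special ⇒ jet-special ⇒ pinch-special (the located class keeps
shrinking).  KERNEL (PROVED). [folklore] -/
theorem isBroadSpecialPt_of_isVastSpecialPt {k : Type} [Field k] {Y : Scheme.{0}} {g : Y ⟶ Spec (.of k)}
    {hY : Scheme.IsRegular Y} {I : Y.IdealSheafData} {n : ℕ} {y : Y} (h : IsVastSpecialPt g hY I n y) :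
    IsBroadSpecialPt g hY I n y :=
  ⟨h.1, fun hB => h.2 (Or.inl hB)⟩

/-- `isWideSpecialPt_of_isVastSpecialPt`: Auxiliary step of this node's calculus, VERBATIM from the lens file (see
the module docstring); the statement is its type. [folklore] -/
theorem isWideSpecialPt_of_isVastSpecialPt {k : Type} [Field k] {Y : Scheme.{0}} {g : Y ⟶ Spec (.of k)}
    {hY : Scheme.IsRegular Y} {I : Y.IdealSheafData} {n : ℕ} {y : Y} (h : IsVastSpecialPt g hY I n y) :
    IsWideSpecialPt g hY I n y :=
  isWideSpecialPt_of_isBroadSpecialPt (isBroadSpecialPt_of_isVastSpecialPt h)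

/-- `isTameSpecialPt_of_isVastSpecialPt`: Auxiliary step of this node's calculus, VERBATIM from the lens file (see
the module docstring); the statement is its type. [folklore] -/
theorem isTameSpecialPt_of_isVastSpecialPt {k : Type} [Field k] {Y : Scheme.{0}} {g : Y ⟶ Spec (.of k)}
    {hY : Scheme.IsRegular Y} {I : Y.IdealSheafData} {n : ℕ} {y : Y} (h : IsVastSpecialPt g hY I n y) :
    IsTameSpecialPt g hY I n y :=
  isTameSpecialPt_of_isBroadSpecialPt (isBroadSpecialPt_of_isVastSpecialPt h)

/-- A vast-curve point is never vast-special.  KERNEL (PROVED). [folklore] -/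
theorem not_isVastSpecialPt_of_isVastCurvePt {k : Type} [Field k] {Y : Scheme.{0}} {g : Y ⟶ Spec (.of k)}
    {hY : Scheme.IsRegular Y} {I : Y.IdealSheafData} {n : ℕ} {y : Y} (h : IsVastCurvePt I n y) :
    ¬ IsVastSpecialPt g hY I n y :=
  fun hs => hs.2 h

namespace Vast

/-! ### §N4 + §NK  sequence level and kernels: the VAST cut, in the sub-namespace `Vast` — a MECHANICAL COPY of §J4 and
§K (via §M4/§MK) with the broad leaf (B) replaced by the vast leaf (V) (`IsBroadCurvePt ↦ IsVastCurvePt`,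
`IsBroadSpecialPt ↦ IsVastSpecialPt`, `BroadExit ↦ VastExit`, names `SeqB… ↦ SeqV…`, `Broad…Rung ↦ Vast…Rung`). -/

/-! ### §N4  The graded statements of the VAST cut (mechanical copy of §J4 with the jet leaf (J) replaced by the
vast leaf (V) = broad ∪ degenerate ladder) -/

/-- **`SeqVGen n`** — weak order reduction in dimension four at marking `n` for data ALL of whose top points are of
class ≥ 2, near-generic (g10), δ-generic (g11), curve-generic (g12), rel-curve-generic or flat-curve (g13), pinch-curve
or cone-curve (g14), or VAST-CURVE points (g15 rev 5: jet-tame-, ladder-, mixed-ladder- or degenerate-ladder-curve).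
 [DECIDED-MOD-PORT relative to `SeqDimFour 2 n`:
`vGenRungAt_of_engines`.]  STATEMENT SCHEMA. (Sources: BierstoneGrigorievMilmanWlodarczyk2011 §3.1; CossartPiltant2008
Prop. 4.2; Hironaka1967.) -/
def SeqVGen (n : ℕ) : Prop :=
  ∀ p : ℕ, p.Prime → ∀ (k : Type) [Field k] [CharP k p]
    (Y : Scheme.{0}) (g : Y ⟶ Spec (.of k)), IsSeparated g → LocallyOfFiniteType g → QuasiCompact g →
    ∀ hY : Scheme.IsRegular Y, topologicalKrullDim Y ≤ 4 →
    ∀ I : Y.IdealSheafData, (∀ y : Y, idealOrder I y ≤ ((n : ℕ) : ℕ∞)) →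
      (∀ y : Y, idealOrder I y = ((n : ℕ) : ℕ∞) →
        ClassGE g hY I n 2 y ∨ VeryNearCutClasses.IsNearGenericPt I n y ∨ IsDeltaGenericPt I n y ∨
          IsCurveGenericPt I n y ∨ IsRelCurveGenericPt I n y ∨ IsFlatCurvePt I n y ∨
          IsPinchCurvePt I n y ∨ IsConeCurvePt I n y ∨ IsVastCurvePt I n y) →
      ∃ t : CentreSeq Y, WeakResolution t (⟨I, [], n⟩ : MarkedIdeal Y)

end Vast

end Summit.ResolutionOfSingularities.ResolutionOfSingularities.Theorems.JetCut
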